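import Summits.PneNP.PneNP.Theses.ConvexRankGates
import Literature.Computability.Complexity.ExtMonotoneCircuits
import Literature.Computability.AlgebraicComplexity.DeterminantalComplexity

/-!
# Crux `Capture` (stmt-PneNP-2659) — ideator 3, round 1: first lemmas of two idea cards

Card A `generic-span-hull-shadow-collapse`: a GRANK gate is the SUPPORT SHADOW of one
determinant (`GRankIsShadow`); single-field GRANK gates are closed under `∨`, `∧`
(`GRankOrClosed`, `GRankAndClosed`) and under composition, so every
`{∧₂, ∨₂} ∪ GRANK_F`-circuit is ONE GRANK gate (`GRankCircuitCollapse`); the constructive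
capture criterion (`MultilinearNonvanishingCapture`) and the quantity `shadowComplexity`.

Card B `cyclic-exponent-door-split`: block systems over an elementary abelian 2-group are ONE
PERM gate (`BlockXorUnsatIsOnePermGate`, covers `F₂[t]/(tᵏ)`-linear algebra for every `k`);
the lattice saturation identity (`LatticeSaturationSplit`); the split
`Capture ↔ CapturePlus ∧ DoorCapture` (`CaptureSplit`).

Statements only (Props); nothing here is a proof of `Capture`.
-/

namespace Summit.PneNP.PneNP.Cruxes.Capture.Ideator3

set_option linter.dupNamespace false

open scoped Classical
open Literature.Computability.Complexity

/-! ## Card A — GRANK is a support shadow; single-field collapse -/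

/-- GRANK gates over a FIXED field `F` (the library's `IsGRankGate` quantifies `∃ F` inside). -/
def IsGRankGateOver (F : Type) [Field F] (s : ℕ) (g : GateFn) : Prop :=
  ∃ (d θ : ℕ), d ≤ s ∧ ∃ (K₀ : Matrix (Fin d) (Fin d) F)
    (K : Fin g.1 → Matrix (Fin d) (Fin d) F),
      ∀ v : Fin g.1 → Bool, g.2 v = true ↔ θ ≤ (symbolicMatrix K₀ K v).rank

/-- Fixing the field only restricts: `IsGRankGateOver F s g → IsGRankGate s g`. -/
theorem IsGRankGateOver.isGRankGate {F : Type} [Field F] {s : ℕ} {g : GateFn}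
    (h : IsGRankGateOver F s g) : IsGRankGate s g := by
  obtain ⟨d, θ, hd, K₀, K, hK⟩ := h
  exact ⟨F, inferInstance, d, θ, hd, K₀, K, hK⟩

/-- The SUPPORT SHADOW of a polynomial: accept `v` iff killing the unselected variables leaves a
non-zero polynomial, i.e. iff some monomial of `P` is supported inside `{i | v i}`. -/
noncomputable def shadow {n : ℕ} {F : Type} [Field F] (P : MvPolynomial (Fin n) F)
    (v : Fin n → Bool) : Bool :=
  decide (killVars v P ≠ 0)

/-- (A1) GRANK = shadow of ONE determinant: `θ ≤ generic rank` iff the determinant of a generic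
`θ × θ` compression `U (K₀ + ∑ Xᵢ Kᵢ) V` (over a purely transcendental extension `F'`) has a
monomial supported in the selected set. -/
def GRankIsShadow : Prop :=
  ∀ (F : Type) [Field F] (s : ℕ) (g : GateFn), IsGRankGateOver F s g →
    ∃ (F' : Type) (_ : Field F') (d : ℕ), d ≤ s ∧
      ∃ (K₀ : Matrix (Fin d) (Fin d) F') (K : Fin g.1 → Matrix (Fin d) (Fin d) F'),
        ∀ v, g.2 v = shadow (symbolicPolyMatrix K₀ K).det v

/-- (A2) `∨`-closure over one field: `shadow P₁ ∨ shadow P₂ = shadow (z₁ P₁ + z₂ P₂)` for fresh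
transcendentals `z₁ z₂`, and `dc (z₁ P₁ + z₂ P₂) ≤ dc P₁ + dc P₂ + O(1)`. -/
def GRankOrClosed : Prop :=
  ∀ (F : Type) [Field F] (n s₁ s₂ : ℕ) (f₁ f₂ : (Fin n → Bool) → Bool),
    IsGRankGateOver F s₁ ⟨n, f₁⟩ → IsGRankGateOver F s₂ ⟨n, f₂⟩ →
      IsGRankGate (s₁ + s₂ + 2) ⟨n, fun v => f₁ v || f₂ v⟩

/-- (A2') `∧`-closure over one field: `shadow P₁ ∧ shadow P₂ = shadow (P₁ P₂)` (block sum of the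
two compressed symbolic matrices). -/
def GRankAndClosed : Prop :=
  ∀ (F : Type) [Field F] (n s₁ s₂ : ℕ) (f₁ f₂ : (Fin n → Bool) → Bool),
    IsGRankGateOver F s₁ ⟨n, f₁⟩ → IsGRankGateOver F s₂ ⟨n, f₂⟩ →
      IsGRankGate (s₁ + s₂) ⟨n, fun v => f₁ v && f₂ v⟩

/-- (A3) COLLAPSE: a circuit over `{∧₂, ∨₂} ∪ GRANK_F,s` of size `m` is ONE GRANK gate of
dimension `poly(m, s)` (composition = substitution `yⱼ := zⱼ · Pⱼ(x)` with fresh transcendentals,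
then Valiant universality `dc ≤ ABP size`). The route docstring of `LinAlgGateBlind` says GRANK
does not collapse; per field it does. -/
def GRankCircuitCollapse : Prop :=
  ∃ c : ℕ, ∀ (F : Type) [Field F] (ι : Type) [Fintype ι] (s : ℕ) (C : Circuit ι)
    (f : (ι → Bool) → Bool),
    C.IsOver ({GateFn.and 2, GateFn.or 2} ∪ {g | IsGRankGateOver F s g}) → C.Computes f →
      ∃ C' : Circuit ι, C'.IsOver {g | IsGRankGate ((C.size + s + 2) ^ c) g} ∧
        C'.size ≤ 1 ∧ C'.Computes f

/-- (A4) Constructive capture criterion: if `D` is MULTILINEAR with an affine determinantal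
representation of size `m`, then the monotone closure of its Boolean non-vanishing set,
`S ↦ [∃ T ⊆ S, D(1_T) ≠ 0]`, is ONE GRANK gate of dimension `m` (minimal monomial supports =
minimal non-vanishing Boolean points for multilinear `D`). Covers Edmonds (BPM), Pfaffian (PM),
Cauchy–Binet (linear matroid intersection), Lovász (linear matroid parity), Laman rigidity. -/
def MultilinearNonvanishingCapture : Prop :=
  ∀ (F : Type) [Field F] (n m : ℕ) (D : MvPolynomial (Fin n) F),
    (∀ i, D.degreeOf i ≤ 1) →
    Literature.Computability.AlgebraicComplexity.HasDetRepr D m →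
      IsGRankGateOver F m ⟨n, fun v => decide (∃ w : Fin n → Bool, w ≤ v ∧
        MvPolynomial.eval (fun i => if w i then (1 : F) else 0) D ≠ 0)⟩

/-- SHADOW COMPLEXITY over `F` of a Boolean function: the least size of an affine determinantal
representation of a polynomial whose support shadow is `f` (junk `0` if none). By (A1)–(A3) this
is, up to `poly`, the single number governing `{∧, ∨, GRANK_F}`-circuit size. -/
noncomputable def shadowComplexity (F : Type) [Field F] {n : ℕ} (f : (Fin n → Bool) → Bool) :
    ℕ :=
  sInf {m : ℕ | ∃ P : MvPolynomial (Fin n) F,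
    Literature.Computability.AlgebraicComplexity.HasDetRepr P m ∧ ∀ v, f v = shadow P v}

/-! ## Card B — the cyclic-exponent door split -/

/-- (B1) Equal characteristic is absorbed: unsatisfiability of a BLOCK-selected affine system
over `𝔽₂` (input `e` selects all `k` equations `a e j · y = b e j`) is a size-one PERM circuit on
`2n+2` points — the `XorUnsatIsOnePermGate` embedding with `k` slots wired to the same input.
Linear algebra over `𝔽₂[t]/(tᵏ)` (additive group elementary abelian) expands to exactly this,
for every `k`; only rings whose additive exponent exceeds `s` (ℤ/pᵏ, pᵏ > s) escape PERM_s
(Disproof §3, `no_zmod_two_pow_embedding`). -/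
def BlockXorUnsatIsOnePermGate : Prop :=
  ∀ (n k : ℕ) (U : Type) [Fintype U] (a : U → Fin k → (Fin n → ZMod 2))
    (b : U → Fin k → ZMod 2),
    ∃ C : Circuit U, C.IsOver {g | IsPermGate (2 * n + 2) g} ∧ C.size = 1 ∧
      C.Computes (fun v => decide (¬ ∃ y : Fin n → ZMod 2,
        ∀ e, v e = true → ∀ j, a e j ⬝ᵥ y = b e j))

/-- (B2) Lattice saturation identity: if `e` kills the torsion of `sat(L)/L`, then
`t ∈ L ↔ (t ∈ ℚ·L) ∧ (t ∈ L + e²ℤᵈ)`. Integer-lattice membership is therefore ONE CONV gate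
(ℚ-span) `∧` ONE module gate of modulus `e(S)²` — a modulus that varies with the selected set,
which is why a repair by ℤ/m-module gates with a FIXED poly-bit modulus per gate is suspect and
the ring `ℤ` itself must be allowed. -/
def LatticeSaturationSplit : Prop :=
  ∀ (d e : ℕ) (L : AddSubgroup (Fin d → ℤ)), 0 < e →
    (∀ x : Fin d → ℤ, (∃ m : ℕ, 0 < m ∧ (m : ℤ) • x ∈ L) → (e : ℤ) • x ∈ L) →
    ∀ t : Fin d → ℤ, t ∈ L ↔
      ((∃ m : ℕ, 0 < m ∧ (m : ℤ) • t ∈ L) ∧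
        ∃ ℓ ∈ L, ∃ z : Fin d → ℤ, t = ℓ + ((e * e : ℕ) : ℤ) • z)

/-- LATTICE gates (refuter C's repair, typed): arity, dimension and entry bit-size `≤ s`; fixed
generators `r₀` (always present, e.g. `m • eᵢ` to emulate ℤ/m), one generator per input; accept
`v` iff `t` lies in the subgroup of `ℤᵈ` generated by `r₀` and the selected generators. Monotone by
syntax; ℤ/m-span programs, XOR-SAT, Cavalar–Oliveira, LIN-UNSAT over ℤ/2ᵏ and over ℤ are one
gate each. -/
def IsLatGate (s : ℕ) (g : GateFn) : Prop :=
  g.1 ≤ s ∧ ∃ d : ℕ, d ≤ s ∧ ∃ (r₀ : Fin s → Fin d → ℤ) (r : Fin g.1 → Fin d → ℤ)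
    (t : Fin d → ℤ), (∀ i j, |r₀ i j| ≤ 2 ^ s) ∧ (∀ i j, |r i j| ≤ 2 ^ s) ∧ (∀ j, |t j| ≤ 2 ^ s) ∧
      ∀ v : Fin g.1 → Bool, g.2 v = true ↔
        t ∈ AddSubgroup.closure (Set.range r₀ ∪ r '' {i | v i = true})

/-- The repaired basis `B⁺_s = B_s ∪ LAT_s`. -/
def extPlus (s : ℕ) : Set GateFn := extGate s ∪ {g | IsLatGate s g}

/-- `Capture⁺`: Capture with the repaired basis (the statement the route wants to be true). -/
def CapturePlus : Prop :=
  ∃ a : ℕ, ∀ (ι : Type) (_ : Fintype ι) (f : (ι → Bool) → Bool), Monotone f →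
    ∀ C : Circuit ι, C.IsOver B2 → C.Computes f →
      ∃ C' : Circuit ι, C'.IsOver (extPlus ((C.size + Fintype.card ι + 2) ^ a)) ∧
        C'.size ≤ (C.size + Fintype.card ι + 2) ^ a ∧ C'.Computes f

/-- `DoorCapture`: Capture restricted to the one explicit family of lattice-membership functions
(the refuters' third door, Disproof §4 `ThirdDoor.linUnsat`, is the instance `r₀ = 2ᵏ • eᵢ`). -/
def DoorCapture : Prop :=
  ∃ a : ℕ, ∀ (k d B : ℕ) (r₀ : Fin B → Fin d → ℤ) (r : Fin k → Fin d → ℤ) (t : Fin d → ℤ),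
    ∀ C : Circuit (Fin k), C.IsOver B2 →
      C.Computes (fun v => decide
        (t ∈ AddSubgroup.closure (Set.range r₀ ∪ r '' {i | v i = true}))) →
      ∃ C' : Circuit (Fin k), C'.IsOver (extGate ((C.size + k + 2) ^ a)) ∧
        C'.size ≤ (C.size + k + 2) ^ a ∧
        C'.Computes (fun v => decide
          (t ∈ AddSubgroup.closure (Set.range r₀ ∪ r '' {i | v i = true})))

/-- (B3) THE SPLIT: the crux is equivalent to the conjunction of its believable core and its
doubtful periphery. `→`: both are special cases (`extGate ⊆ extPlus`; lattice membership is
monotone and in P). `←`: replace every LAT gate of the `Capture⁺` circuit (arity, dimension,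
bit-size `≤ S`, hence B2-size `poly(S)` by Hermite normal form) by the `DoorCapture` circuit and
plug (`GateList.plug`). -/
def CaptureSplit : Prop :=
  Summit.PneNP.PneNP.Theses.ConvexRankGates.Capture ↔ (CapturePlus ∧ DoorCapture)

end Summit.PneNP.PneNP.Cruxes.Capture.Ideator3
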